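import Summits.QuantumFields.YangMills.Theorems.FluctuationComparisonRegPrIntLBackgroundFormOfPolymerPackage
import HarnessLib

/-!
# BGFORM∘ FROM POLY∘ — the background form of the fluctuation part is implied by its polymer form (texts inline, def-free)

Cell `ym3-torus` (YM ladder rung R3 = continuum `SU(2)` Yang–Mills on the three-torus — a RUNG, NOT d = 4, NOT infinite volume, NOT a mass gap,
NOT Clay).  Crux of record `stmt-QuantumFields-20520` = `UnitScaleTilt.FluctuationComparisonRegPrIntL` (DECIDING); this file is a HELPER
(`--supports`), it closes nothing and registers nothing (★★OWNER RULING №36: organ-level lines are published, not registered).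

WHAT.  Two published organ-level rows for the PATH-B organ S2β are related by a KERNEL junction:
* **POLY∘** `FluctuationPolymerCan` (LINE g24-3 «polymer form», `Cruxes/FluctuationComparisonRegPrIntL/Lines/polymer_form.lean` §1, v2; = the binder `hP` of
  ✓`…Theorems.FluctuationComparisonRegPrIntLPolymerNormKnit.fluctuationPartSmall_of_polymer`): on the window, `log ρ U + β_K𝔄^reg U = c₀ + Σ_X T X U` with terms
  EXACTLY local in the window field (i), pinned one-bond oscillation moduli `w X` (ii) with one-pin sums `≤ φ_J` (iii) and two-pin sums `≤ φ_J e^{−κ·tdist}` (iv),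
  `φ` super-polynomially small;
* **BGFORM∘** `FluctuationBackgroundFormCan` (LINE g24-4 «background form», `…/Lines/background_form.lean` §1; = the binder `hB` of
  `…Theorems.FluctuationComparisonRegPrIntLBackgroundFormKnit.fluctuationPartSmall_of_backgroundForm`): `log ρ U + β_K𝔄^reg U = c₀ + Σ_X T X (M U)` through a
  BACKGROUND MAP `M` into coordinates on the fine bonds of level `K`, terms Lipschitz ∕ discrete-C¹·¹ in the background variables with summable moduli, and
  exponentially localized one- and mixed two-bond RESPONSES of `M` in a volume-uniformly summable pseudo-metric `d` comparable with `κ·tdist_J`.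
The card of LINE g24-4 REMARKS that BGFORM∘ is weaker than POLY∘ («not formalised here (different index levels)»).  ★`backgroundForm_of_polymer :
⟨POLY∘⟩ → ⟨BGFORM∘⟩` proves it with the encoding of `…BackgroundFormOfPolymerPackage.backgroundForm_package` (background variables := the bond-distributed
TERM VALUES, one LINEAR readout term, `d := (κ∕4)·tdist_J` on the image of the val-cast anchor `π` and `Dbig` off it): frame passed through; constants
`κ_BG := κ∕4`, `μ := 1`, `C := 3·K₁(3,κ∕4) + 1`, `A := 1`, `Hc := 0`; moduli `σ := φ`, `σ₂ := 2φ`; per window `t := tdist_J` of bond sources (a pseudo-metric via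
the isometry ✓`exists_siteEquiv_pl1`), the anchor `π b := (val-cast of b.src into ZMod (2L^{m+K}), b.dir)` (injective since `2L^{m+J} ≤ 2L^{m+K}`), and
`c₀′ := c₀ + T ∅ U₀`.

DEGENERATE BY DESIGN (one honest sentence for the record, LEAD w3-20520 g20's ask): the witness has `h := 0`, a SINGLE global LINEAR term `T′ univ` and a background
map that is discontinuous in the window field — all locality and all decay are carried by the RESPONSE clauses; so BGFORM∘'s Lipschitz ∕ C¹·¹ ∕ pin-sum clauses
alone do not force print's term-locality in `X` — information about the ROW (how much weaker than POLY∘ it is), not about print.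

CONSEQUENCE FOR THE RECORD (problem-relative, honest).  With the landed chain BAL-GAS∘ → POLYᵃ∘ → POLYᵗ∘ → POLYⁿ∘ → POLY∘ (`…PolymerGasKnit`, `…PolymerAnalyticKnit`,
`…PolymerTreeKnit`, `…PolymerNormKnit`), LINE g24-4's one stub BGFORM∘ is implied by every letter of LINE g24-3; S2β and GRAD∘ follow from BGFORM∘ by
`…BackgroundFormKnit` (the ideator's proved algebra).  Nothing here asserts POLY∘, BGFORM∘, S2β, GRAD∘, `FluctuationComparisonRegPrIntL` (20520) or `YM3TorusSU2`;
no Literature fact is used or restated; both row texts are INLINE and VERBATIM (no `def`); rung R3 = SU(2) YM₃ on T³ — NOT d = 4, NOT infinite volume, NOT a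
mass gap, NOT Clay.
-/

noncomputable section

namespace Summit.QuantumFields.YangMills.Theorems.FluctuationComparisonRegPrIntLBackgroundFormOfPolymer

open MeasureTheory Filter Topology Set
open scoped BigOperators
open Literature.MathematicalPhysics.QuantumFieldTheory.Balaban1983to89
open Literature.MathematicalPhysics.QuantumFieldTheory.Balaban1983to89.T3ContinuumYM3Torus
open Literature.MathematicalPhysics.QuantumFieldTheory.Balaban1983to89.T3NestedUnitLaws
open Literature.MathematicalPhysics.QuantumFieldTheory.Balaban1983to89.T3UnitLawDensityEML
open Literature.MathematicalPhysics.QuantumFieldTheory.Balaban1983to89.T3UnitScaleTilt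
open Literature.MathematicalPhysics.QuantumFieldTheory.Balaban1983to89.T3TiltDescent
open Literature.MathematicalPhysics.QuantumFieldTheory.Balaban1983to89.T3PrintedRegularMinimiser
open Literature.MathematicalPhysics.QuantumFieldTheory.Balaban1983to89.T3LevelShift
open Literature.MathematicalPhysics.QuantumFieldTheory.Balaban1983to89.Missing
open Literature.MathematicalPhysics.QuantumFieldTheory.Balaban1983to89.T4Continuum
open Literature.MathematicalPhysics.QuantumFieldTheory.Balaban1983to89.B12Decay510Torus (pl1 pl1_sub_comm pl1_sub_triangle sum_exp_pl1_le_K₁)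
open Literature.MathematicalPhysics.QuantumFieldTheory.Balaban1983to89.B12Decay510Window (K₁ K₁_nonneg)
open Summit.QuantumFields.YangMills.Theorems.FluctuationComparisonRegPrIntLPolymerTreeKnit (exists_siteEquiv_pl1)
open Summit.QuantumFields.YangMills.Theorems.FluctuationComparisonRegPrIntLBackgroundFormOfPolymerPackage
  (backgroundForm_package sum_bond_exp_neg_tdist_le)

/-! ## ★ BGFORM∘ from POLY∘ -/

/-- ★ **BGFORM∘ ⟸ POLY∘**: the background-form row `FluctuationBackgroundFormCan` of LINE g24-4 (`Cruxes/FluctuationComparisonRegPrIntL/Lines/background_form.lean` §1,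
VERBATIM as the conclusion) follows from the polymer-form row `FluctuationPolymerCan` of LINE g24-3 (`…/Lines/polymer_form.lean` §1 v2, VERBATIM as the binder `hP`;
= the binder of ✓`…PolymerNormKnit.fluctuationPartSmall_of_polymer`).  Frame passed through; constants `κ∕4, 1, 3·K₁(3,κ∕4)+1, 1, 0`; moduli `σ := φ`, `σ₂ := 2φ`;
per window the package `backgroundForm_package` with `t := tdist_J` of bond sources (a pseudo-metric through the isometry ✓`exists_siteEquiv_pl1`), the val-cast anchor and
`c₀′ := c₀ + T ∅ U₀`.  Problem-relative: a junction between two HYPOTHESIS rows; neither is asserted; S2β ∕ 20520 ∕ `YM3TorusSU2` are not touched; rung R3 —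
NOT d = 4, NOT infinite volume, NOT a mass gap, NOT Clay.
[cite: Balaban1987RG1, (0.22)-(0.25) pp.256-257 and (5.10) p.293; Balaban1985Variational, Prop. 9 p.309, (182)-(190) pp.307-308] -/
theorem backgroundForm_of_polymer
    (hP : ∀ (L : ℕ), ∃ pS : ℝ, ∀ (b₀ p₀ : ℝ), 0 < b₀ → pS ≤ p₀ → 0 < p₀ → ∃ ε₁ : ℝ, 0 < ε₁ ∧ ∀ (ε₀ : ℝ), 0 < ε₀ → ε₀ ≤ ε₁ →
      ∃ γ₁ : ℝ, 0 < γ₁ ∧ ∃ κ : ℝ, 0 < κ ∧ ∀ (F : T3Family) (γ : ℝ), F.L = L → 0 < γ → γ ≤ γ₁ →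
        ∃ (φ : ℕ → ℝ), (∀ J, 0 ≤ φ J) ∧ (∀ a : ℕ, Tendsto (fun J : ℕ => ((J : ℝ) + 1) ^ a * φ J) atTop (𝓝 0)) ∧
          ∀ (ν : ℕ → (j : ℕ) → Measure (GaugeField (F.P j) 0 (Matrix.specialUnitaryGroup (Fin 2) ℂ))),
            (∀ K, ν K K = T4GenFunBounds.gibbsMeasure (F.P K) ((F.scheme ℰp γ).β K)) →
            (∀ K j, j < K → ν K j = Measure.map (descend F ℰp j) (ν K (j + 1))) →
            ∀ (J K : ℕ) (hJK : J ≤ K) (ρ : GaugeField (F.P J) 0 (Matrix.specialUnitaryGroup (Fin 2) ℂ) → ℝ),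
              (∀ U, PlaqSmall (θBal F.L γ b₀ p₀ J) U → 0 < ρ U) →
              ν K J = (fieldMeasure _ _ _).withDensity (fun U => ENNReal.ofReal (ρ U)) →
              ContinuousOn ρ {U | PlaqSmall (θBal F.L γ b₀ p₀ J) U} →
              ∃ (c₀ : ℝ) (T : Finset (PBond (F.P J) 0) → GaugeField (F.P J) 0 (Matrix.specialUnitaryGroup (Fin 2) ℂ) → ℝ)
                (w : Finset (PBond (F.P J) 0) → ℝ),
                (∀ (X : Finset (PBond (F.P J) 0)) (U V : GaugeField (F.P J) 0 (Matrix.specialUnitaryGroup (Fin 2) ℂ)),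
                    (∀ e ∈ X, U e = V e) → T X U = T X V) ∧
                (∀ (X : Finset (PBond (F.P J) 0)) (b : PBond (F.P J) 0) (U V : GaugeField (F.P J) 0 (Matrix.specialUnitaryGroup (Fin 2) ℂ)),
                    PlaqSmall (θBal F.L γ b₀ p₀ J) U → PlaqSmall (θBal F.L γ b₀ p₀ J) V → (∀ e, e ≠ b → U e = V e) → |T X U - T X V| ≤ w X) ∧
                (∀ b : PBond (F.P J) 0, ∑ X ∈ Finset.univ.filter (fun X => b ∈ X), w X ≤ φ J) ∧
                (∀ b b' : PBond (F.P J) 0,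
                    ∑ X ∈ Finset.univ.filter (fun X => b ∈ X ∧ b' ∈ X), w X ≤ φ J * Real.exp (-(κ * (b.src.tdist b'.src : ℝ)))) ∧
                (∀ U : GaugeField (F.P J) 0 (Matrix.specialUnitaryGroup (Fin 2) ℂ), PlaqSmall (θBal F.L γ b₀ p₀ J) U →
                    Real.log (ρ U) + (F.scheme ℰp γ).β K * minActionRegPr F J K hJK ε₀ U = c₀ + ∑ X, T X U)) :
  ∀ (L : ℕ), ∃ pS : ℝ, ∀ (b₀ p₀ : ℝ), 0 < b₀ → pS ≤ p₀ → 0 < p₀ → ∃ ε₁ : ℝ, 0 < ε₁ ∧ ∀ (ε₀ : ℝ), 0 < ε₀ → ε₀ ≤ ε₁ →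
    ∃ γ₁ : ℝ, 0 < γ₁ ∧ ∃ (κ μ C A Hc : ℝ), 0 < κ ∧ 0 ≤ μ ∧ 0 ≤ A ∧ 0 ≤ Hc ∧ ∀ (F : T3Family) (γ : ℝ), F.L = L → 0 < γ → γ ≤ γ₁ →
      ∃ (σ σ₂ : ℕ → ℝ), (∀ J, 0 ≤ σ J) ∧ (∀ J, 0 ≤ σ₂ J) ∧
        (∀ a : ℕ, Tendsto (fun J : ℕ => ((J : ℝ) + 1) ^ a * σ J) atTop (𝓝 0)) ∧
        (∀ a : ℕ, Tendsto (fun J : ℕ => ((J : ℝ) + 1) ^ a * σ₂ J) atTop (𝓝 0)) ∧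
        ∀ (ν : ℕ → (j : ℕ) → Measure (GaugeField (F.P j) 0 (Matrix.specialUnitaryGroup (Fin 2) ℂ))),
          (∀ K, ν K K = T4GenFunBounds.gibbsMeasure (F.P K) ((F.scheme ℰp γ).β K)) →
          (∀ K j, j < K → ν K j = Measure.map (descend F ℰp j) (ν K (j + 1))) →
          ∀ (J K : ℕ) (hJK : J ≤ K) (ρ : GaugeField (F.P J) 0 (Matrix.specialUnitaryGroup (Fin 2) ℂ) → ℝ),
            (∀ U, PlaqSmall (θBal F.L γ b₀ p₀ J) U → 0 < ρ U) →
            ν K J = (fieldMeasure _ _ _).withDensity (fun U => ENNReal.ofReal (ρ U)) →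
            ContinuousOn ρ {U | PlaqSmall (θBal F.L γ b₀ p₀ J) U} →
            ∃ (c₀ : ℝ) (π : PBond (F.P J) 0 → PBond (F.P K) 0) (d : PBond (F.P K) 0 → PBond (F.P K) 0 → ℝ)
              (M : GaugeField (F.P J) 0 (Matrix.specialUnitaryGroup (Fin 2) ℂ) → PBond (F.P K) 0 → (Fin 8 → ℝ))
              (T : Finset (PBond (F.P K) 0) → (PBond (F.P K) 0 → (Fin 8 → ℝ)) → ℝ)
              (ℓ h : Finset (PBond (F.P K) 0) → ℝ),
              (∀ x y, 0 ≤ d x y) ∧ (∀ x y, d x y = d y x) ∧ (∀ x y z, d x z ≤ d x y + d y z) ∧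
              (∀ x, ∑ y, Real.exp (-(μ * d x y)) ≤ C) ∧
              (∀ b b' : PBond (F.P J) 0, κ * (b.src.tdist b'.src : ℝ) ≤ μ * d (π b) (π b')) ∧
              (∀ X, 0 ≤ ℓ X) ∧ (∀ X, 0 ≤ h X) ∧
              (∀ e, ∑ X ∈ Finset.univ.filter (fun X => e ∈ X), ℓ X ≤ A) ∧
              (∀ e e', ∑ X ∈ Finset.univ.filter (fun X => e ∈ X ∧ e' ∈ X), h X ≤ Hc * Real.exp (-(2 * μ * d e e'))) ∧
              (∀ (X : Finset (PBond (F.P K) 0)) (U V : GaugeField (F.P J) 0 (Matrix.specialUnitaryGroup (Fin 2) ℂ)),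
                  PlaqSmall (θBal F.L γ b₀ p₀ J) U → PlaqSmall (θBal F.L γ b₀ p₀ J) V →
                  |T X (M U) - T X (M V)| ≤ ℓ X * ∑ e ∈ X, ‖M U e - M V e‖) ∧
              (∀ (X : Finset (PBond (F.P K) 0)) (U V W Z : GaugeField (F.P J) 0 (Matrix.specialUnitaryGroup (Fin 2) ℂ)),
                  PlaqSmall (θBal F.L γ b₀ p₀ J) U → PlaqSmall (θBal F.L γ b₀ p₀ J) V →
                  PlaqSmall (θBal F.L γ b₀ p₀ J) W → PlaqSmall (θBal F.L γ b₀ p₀ J) Z →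
                  |T X (M U) - T X (M W) - T X (M V) + T X (M Z)| ≤
                    h X * (∑ e ∈ X, ‖M W e - M Z e‖) * (∑ e ∈ X, ‖M V e - M Z e‖) +
                      ℓ X * ∑ e ∈ X, ‖M U e - M W e - M V e + M Z e‖) ∧
              (∀ (b : PBond (F.P J) 0) (U V : GaugeField (F.P J) 0 (Matrix.specialUnitaryGroup (Fin 2) ℂ)),
                  PlaqSmall (θBal F.L γ b₀ p₀ J) U → PlaqSmall (θBal F.L γ b₀ p₀ J) V → (∀ e, e ≠ b → U e = V e) →
                  ∀ e, ‖M U e - M V e‖ ≤ σ J * Real.exp (-(2 * μ * d (π b) e))) ∧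
              (∀ (b b' : PBond (F.P J) 0) (U V W Z : GaugeField (F.P J) 0 (Matrix.specialUnitaryGroup (Fin 2) ℂ)),
                  PlaqSmall (θBal F.L γ b₀ p₀ J) U → PlaqSmall (θBal F.L γ b₀ p₀ J) V →
                  PlaqSmall (θBal F.L γ b₀ p₀ J) W → PlaqSmall (θBal F.L γ b₀ p₀ J) Z →
                  (∀ e, e ≠ b → U e = V e) → (∀ e, e ≠ b' → U e = W e) → (∀ e, e ≠ b' → V e = Z e) → (∀ e, e ≠ b → W e = Z e) →
                  ∀ e, ‖M U e - M W e - M V e + M Z e‖ ≤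
                    σ₂ J * (Real.exp (-(2 * μ * d (π b) e)) * Real.exp (-(2 * μ * d e (π b'))))) ∧
              (∀ U : GaugeField (F.P J) 0 (Matrix.specialUnitaryGroup (Fin 2) ℂ), PlaqSmall (θBal F.L γ b₀ p₀ J) U →
                  Real.log (ρ U) + (F.scheme ℰp γ).β K * minActionRegPr F J K hJK ε₀ U = c₀ + ∑ X, T X (M U)) := by
  classical
  intro L
  obtain ⟨pS, hpS⟩ := hP L
  refine ⟨pS, fun b₀ p₀ hb₀ hpS₀ hp₀ => ?_⟩
  obtain ⟨ε₁, hε₁, hε⟩ := hpS b₀ p₀ hb₀ hpS₀ hp₀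
  refine ⟨ε₁, hε₁, fun ε₀ hε₀ hε₀₁ => ?_⟩
  obtain ⟨γ₁, hγ₁, κ, hκ, hF⟩ := hε ε₀ hε₀ hε₀₁
  refine ⟨γ₁, hγ₁, κ / 4, 1, 3 * K₁ 3 (κ / 4) + 1, 1, 0, by positivity, zero_le_one, zero_le_one, le_rfl, fun F γ hFL hγ hγ₁' => ?_⟩
  obtain ⟨φ, hφ0, hφsp, hν⟩ := hF F γ hFL hγ hγ₁'
  refine ⟨φ, fun J => 2 * φ J, hφ0, fun J => by have := hφ0 J; positivity, hφsp, fun a => ?_, fun ν hTop hCons J K hJK ρ hpos hdens hcont => ?_⟩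
  · have h := (hφsp a).const_mul 2
    rw [mul_zero] at h
    refine h.congr' (Eventually.of_forall fun J => ?_)
    simp only; ring
  obtain ⟨c₀, T, w, hi, hii, hiii, hiv, hv⟩ := hν ν hTop hCons J K hJK ρ hpos hdens hcont
  -- the anchor: val-cast of the source, same direction
  have hle : (F.P J).sitesPerDir 0 ≤ (F.P K).sitesPerDir 0 := by
    show 2 * F.L ^ (F.m + J - 0) ≤ 2 * F.L ^ (F.m + K - 0)
    have hL : 0 < F.L := by have := F.hL.2; omega
    exact Nat.mul_le_mul_left 2 (Nat.pow_le_pow_right hL (by omega))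
  let π : PBond (F.P J) 0 → PBond (F.P K) 0 := fun b =>
    ⟨fun μ => (((b.src μ).val : ℕ) : ZMod ((F.P K).sitesPerDir 0)), b.dir⟩
  have hπ : Function.Injective π := by
    intro b₁ b₂ h
    have hsrc0 : (π b₁).src = (π b₂).src := congrArg PBond.src h
    have hdir0 : (π b₁).dir = (π b₂).dir := congrArg PBond.dir h
    have hsrc : ∀ μ, (((b₁.src μ).val : ℕ) : ZMod ((F.P K).sitesPerDir 0)) = (((b₂.src μ).val : ℕ) : ZMod ((F.P K).sitesPerDir 0)) :=
      fun μ => congrFun hsrc0 μ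
    have hdir : b₁.dir = b₂.dir := hdir0
    have hs : b₁.src = b₂.src := by
      funext μ
      have h1 := congrArg ZMod.val (hsrc μ)
      rw [ZMod.val_natCast, ZMod.val_natCast, Nat.mod_eq_of_lt (lt_of_lt_of_le (ZMod.val_lt _) hle),
        Nat.mod_eq_of_lt (lt_of_lt_of_le (ZMod.val_lt _) hle)] at h1
      exact ZMod.val_injective _ h1
    cases b₁; cases b₂; simp only at hs hdir; subst hs; subst hdir; rfl
  -- the level-J bond pseudo-metric
  obtain ⟨e, -, he⟩ := exists_siteEquiv_pl1 F J (N := (F.P J).sitesPerDir 0) (M := 1) (by simp)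
  haveI : Nonempty (PBond (F.P J) 0) := ⟨⟨default, ⟨0, by rw [T3Family.P_d]; norm_num⟩⟩⟩
  obtain ⟨d, M, T', ℓ, h, hd0, hdsymm, hdtri, hdsum, hdanc, hℓ0, hh0, hℓ1, hh2, hLip, hC11, hR1, hR2, hrep⟩ :=
    backgroundForm_package {U | PlaqSmall (θBal F.L γ b₀ p₀ J) U} (fun b b' : PBond (F.P J) 0 => (b.src.tdist b'.src : ℝ))
      (fun b b' => Nat.cast_nonneg _) (fun b b' => by rw [he, he, pl1_sub_comm])
      (fun b b' b'' => by rw [he, he, he]; exact pl1_sub_triangle _ _ _) π hπ T w hκ (hφ0 J)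
      (by have := K₁_nonneg 3 (κ / 4); positivity) hi hii hiv
      (fun b => sum_bond_exp_neg_tdist_le F J (by positivity) b)
  refine ⟨c₀ + T ∅ (fun _ => 1), π, d, M, T', ℓ, h, hd0, hdsymm, hdtri, hdsum, hdanc, hℓ0, hh0, hℓ1, hh2,
    fun X U V hU hV => hLip X U V hU hV, fun X U V W Z hU hV hW hZ => hC11 X U V W Z hU hV hW hZ,
    fun b U V hU hV hUV => hR1 b U V hU hV hUV,
    fun b b' U V W Z hU hV hW hZ h₁ h₂ h₃ h₄ => hR2 b b' U V W Z hU hV hW hZ h₁ h₂ h₃ h₄, fun U hU => ?_⟩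
  rw [hv U hU, hrep U, hi ∅ U (fun _ => 1) fun e he => (Finset.notMem_empty e he).elim]
  ring

end Summit.QuantumFields.YangMills.Theorems.FluctuationComparisonRegPrIntLBackgroundFormOfPolymer

end
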